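import Mathlib.Combinatorics.Hall.Basic
import Mathlib.Algebra.Order.BigOperators.Group.Finset
import Mathlib.Algebra.BigOperators.Group.Finset.Piecewise
import Mathlib.Data.Fintype.Prod
import Mathlib.Data.Fintype.Sum
import Mathlib.Tactic.FinCases
import Mathlib.Tactic.Linarith

/-!
# Route «KPlusLogSqLaw», crux `TropicalB` (stmt-ValiantsHypothesis-19771) — LEX-NT, part 2 (combinatorics):
# three perfect matchings minus a transversal perfect matching split into two transversal perfect matchings
# (Kőnig / P. Hall for the `2`-regular bipartite MULTIgraph, in slot form)

HONEST FRAMING.  Pure finite combinatorics (no designs, no dominance); part 2 of the all-`m` law LEX-NT of seat val-sym-trop-p5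
(g13 conjecture, g14 proof, 2026-08-28; cell `pub-symmetroid`, `--supports stmt-ValiantsHypothesis-19771 --as helper`).  Nothing here
bears on `TropicalB` in its window, `WeakLifting`, DoorA26 / DoorA34, `MatrixDescartes` (stmt-ValiantsHypothesis-18050) or VP ≠ VNP.

CONTENT (`two_factor`).  Three injective «row maps» `r 0, r 1, r 2 : Fin m → Fin m` (the permutations of three Leibniz terms: a
`3`-regular bipartite multigraph on columns × rows, one edge per (column, SLOT)), and a slot choice `sM : Fin m → Fin 3` whose row map
`b ↦ r (sM b) b` is injective (a transversal perfect matching `M`).  Then there are slot choices `s₁, s₂`, pointwise distinct from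
`sM` and from each other, whose row maps are BOTH injective: the `2`-regular remainder `G − M` is the union of two transversal perfect
matchings.  Proof: every row receives at most two free (column, slot) pairs (`card_free_le_two`: the third pair at that row is the one
`M` uses), so P. Hall's condition holds for «column ↦ rows of its two free slots» (double counting, `Finset.card_le_mul_card_image`);
Hall (Mathlib `Finset.all_card_le_biUnion_card_iff_exists_injective`) gives `s₁`, and the leftover slot `s₂` is injective because
three distinct free pairs on one row are too many.  Parallel edges (two slots of one column on the same row) need no special case in
the slot form — this is why the multigraph is carried as slots.  [folklore: Kőnig 1916 / P. Hall 1935; slot packaging this cell]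
-/

set_option linter.dupNamespace false
set_option autoImplicit false

namespace Summit.ValiantsHypothesis.ValiantsHypothesis.Theorems.KPlusLogSqLaw

namespace LexCore

open Finset

/-- two distinct slots leave a third one. [this cell] -/
theorem exists_third : ∀ a b : Fin 3, a ≠ b → ∃ c : Fin 3, c ≠ a ∧ c ≠ b := by
  decide

/-- three pairwise distinct slots exhaust `Fin 3`: any slot is one of them. [this cell] -/
theorem slot_cases : ∀ a b c s : Fin 3, a ≠ b → a ≠ c → b ≠ c → s = a ∨ s = b ∨ s = c := by
  decide

variable {m : ℕ}

/-- **at most two free pairs per row.**  With `M = (b ↦ r (sM b) b)` injective, every row `a` carries at most two pairs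
`(b, s)` with `s ≠ sM b` and `r s b = a` (the slots are injective in `b`, and the slot `sM b₀` of the column `b₀` that `M` puts on
`a` is excluded). [this cell] -/
theorem card_free_le_two (r : Fin 3 → Fin m → Fin m) (hr : ∀ s, Function.Injective (r s)) (sM : Fin m → Fin 3)
    (hM : Function.Injective fun b => r (sM b) b) (a : Fin m) :
    ((univ : Finset (Fin m × Fin 3)).filter fun p => r p.2 p.1 = a ∧ p.2 ≠ sM p.1).card ≤ 2 := by
  classical
  have hMs : Function.Surjective (fun b => r (sM b) b) := Finite.injective_iff_surjective.mp hM
  obtain ⟨b₀, hb₀⟩ := hMs a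
  simp only at hb₀
  set F := (univ : Finset (Fin m × Fin 3)).filter fun p => r p.2 p.1 = a ∧ p.2 ≠ sM p.1 with hF
  have hinj : Set.InjOn Prod.snd (F : Set (Fin m × Fin 3)) := by
    intro p hp q hq hpq
    have hp' := (Finset.mem_filter.mp (Finset.mem_coe.mp hp)).2
    have hq' := (Finset.mem_filter.mp (Finset.mem_coe.mp hq)).2
    have h1 : p.1 = q.1 := by
      apply hr p.2
      rw [hp'.1]
      have := hq'.1
      rw [← hpq] at this
      rw [this]
    exact Prod.ext h1 hpq
  have hmaps : Set.MapsTo Prod.snd (F : Set (Fin m × Fin 3)) ((univ : Finset (Fin 3)).erase (sM b₀) : Set (Fin 3)) := by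
    intro p hp
    have hp' := (Finset.mem_filter.mp (Finset.mem_coe.mp hp)).2
    rw [Finset.mem_coe, Finset.mem_erase]
    refine ⟨fun hs => ?_, Finset.mem_univ _⟩
    have h1 : p.1 = b₀ := by
      apply hr (sM b₀)
      rw [hb₀, ← hs, hp'.1]
    exact hp'.2 (by rw [hs, h1])
  have h := Finset.card_le_card_of_injOn Prod.snd hmaps hinj
  rw [Finset.card_erase_of_mem (Finset.mem_univ _), Finset.card_univ, Fintype.card_fin] at h
  exact h

/-- **KŐNIG / HALL SPLIT IN SLOT FORM.**  Three injective row maps and an injective transversal `sM`; then the free slots split into two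
injective transversals `s₁`, `s₂` (pointwise `sM b`, `s₁ b`, `s₂ b` pairwise distinct). [folklore: Kőnig 1916, P. Hall 1935; this packaging] -/
theorem two_factor (r : Fin 3 → Fin m → Fin m) (hr : ∀ s, Function.Injective (r s)) (sM : Fin m → Fin 3)
    (hM : Function.Injective fun b => r (sM b) b) :
    ∃ s₁ s₂ : Fin m → Fin 3, (∀ b, s₁ b ≠ sM b) ∧ (∀ b, s₂ b ≠ sM b) ∧ (∀ b, s₁ b ≠ s₂ b) ∧
      Function.Injective (fun b => r (s₁ b) b) ∧ Function.Injective (fun b => r (s₂ b) b) := by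
  classical
  have hFa := card_free_le_two r hr sM hM
  -- the free rows of a column
  set t : Fin m → Finset (Fin m) := fun b => ((univ : Finset (Fin 3)).erase (sM b)).image fun s => r s b with ht
  -- P. Hall's condition by double counting
  have hall : ∀ S : Finset (Fin m), S.card ≤ (S.biUnion t).card := by
    intro S
    set E : Finset (Fin m × Fin 3) := (S ×ˢ (univ : Finset (Fin 3))).filter fun p => p.2 ≠ sM p.1 with hE
    set f : Fin m × Fin 3 → Fin m := fun p => r p.2 p.1 with hf
    -- `|E| = 2 |S|`
    have hEcard : E.card = 2 * S.card := by
      have h2 : ∀ b : Fin m, (((univ : Finset (Fin 3)).filter fun s => s ≠ sM b).card : ℕ) = 2 := by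
        intro b
        rw [Finset.filter_ne' , Finset.card_erase_of_mem (Finset.mem_univ _), Finset.card_univ, Fintype.card_fin]
      rw [hE, Finset.card_filter, Finset.sum_product]
      have : ∀ b ∈ S, (∑ s : Fin 3, if (b, s).2 ≠ sM (b, s).1 then 1 else 0) = 2 := by
        intro b _
        rw [← h2 b, Finset.card_filter]
      rw [Finset.sum_const_nat this, mul_comm]
    -- fibres of `f` on `E` have at most two elements
    have hfib : ∀ a ∈ E.image f, (E.filter fun p => f p = a).card ≤ 2 := by
      intro a _
      refine le_trans (Finset.card_le_card ?_) (hFa a)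
      intro p hp
      obtain ⟨hpE, hpa⟩ := Finset.mem_filter.mp hp
      obtain ⟨-, hps⟩ := Finset.mem_filter.mp hpE
      exact Finset.mem_filter.mpr ⟨Finset.mem_univ _, hpa, hps⟩
    have h1 : E.card ≤ 2 * (E.image f).card := Finset.card_le_mul_card_image E 2 hfib
    -- the image lies in the union of the free rows
    have h2 : E.image f ⊆ S.biUnion t := by
      intro a ha
      obtain ⟨p, hpE, hpa⟩ := Finset.mem_image.mp ha
      obtain ⟨hpS, hps⟩ := Finset.mem_filter.mp hpE
      rw [Finset.mem_product] at hpS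
      rw [Finset.mem_biUnion]
      refine ⟨p.1, hpS.1, ?_⟩
      simp only [ht, Finset.mem_image, Finset.mem_erase, Finset.mem_univ, and_true]
      exact ⟨p.2, hps, hpa⟩
    have h3 := Finset.card_le_card h2
    omega
  obtain ⟨g, hg, hgt⟩ := (Finset.all_card_le_biUnion_card_iff_exists_injective t).1 hall
  -- the first transversal reads its slot off `g`
  have hs1 : ∀ b, ∃ s, s ≠ sM b ∧ r s b = g b := by
    intro b
    have hb := hgt b
    simp only [ht, Finset.mem_image, Finset.mem_erase, Finset.mem_univ, and_true] at hb
    obtain ⟨s, hs, hsb⟩ := hb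
    exact ⟨s, hs, hsb⟩
  choose s₁ hs₁ne hs₁eq using hs1
  -- the second transversal takes the leftover slot
  have hs2 : ∀ b, ∃ c : Fin 3, c ≠ sM b ∧ c ≠ s₁ b := fun b => exists_third (sM b) (s₁ b) (hs₁ne b).symm
  choose s₂ hs₂M hs₂1 using hs2
  refine ⟨s₁, s₂, hs₁ne, hs₂M, fun b => (hs₂1 b).symm, ?_, ?_⟩
  · -- `s₁` is `g`
    have : (fun b => r (s₁ b) b) = g := funext hs₁eq
    rw [this]; exact hg
  · -- the leftover transversal: three distinct free pairs on one row are too many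
    intro b b' h
    simp only at h
    by_contra hne
    set a := r (s₂ b) b with ha
    have hgs : Function.Surjective g := Finite.injective_iff_surjective.mp hg
    obtain ⟨b₁, hb₁⟩ := hgs a
    rw [← hs₁eq b₁] at hb₁
    set F := (univ : Finset (Fin m × Fin 3)).filter fun p => r p.2 p.1 = a ∧ p.2 ≠ sM p.1 with hF
    have m1 : (b, s₂ b) ∈ F := Finset.mem_filter.mpr ⟨Finset.mem_univ _, rfl, hs₂M b⟩
    have m2 : (b', s₂ b') ∈ F := Finset.mem_filter.mpr ⟨Finset.mem_univ _, h.symm, hs₂M b'⟩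
    have m3 : (b₁, s₁ b₁) ∈ F := Finset.mem_filter.mpr ⟨Finset.mem_univ _, hb₁, hs₁ne b₁⟩
    have hlt : 2 < F.card := by
      rw [Finset.two_lt_card_iff]
      refine ⟨_, _, _, m1, m2, m3, ?_, ?_, ?_⟩
      · intro e; exact hne (Prod.mk.inj e).1
      · intro e
        obtain ⟨e1, e2⟩ := Prod.mk.inj e
        subst e1
        exact hs₂1 b e2
      · intro e
        obtain ⟨e1, e2⟩ := Prod.mk.inj e
        subst e1
        exact hs₂1 b' e2
    exact absurd (hFa a) (not_le.mpr hlt)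

end LexCore

end Summit.ValiantsHypothesis.ValiantsHypothesis.Theorems.KPlusLogSqLaw
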